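import Literature.Probability.RandomPlanarGeometry.SLERealFlowIto
import Literature.Analysis.FunctionSpaces.ItoFormulaProofs
import HarnessLib

/-!
# Generator martingales of the stopped real SLE_κ flow

Topic `Probability/RandomPlanarGeometry`; theorems only (sequel of `SLERealFlowIto`). This file
supplies the **Itô step** behind the one-point martingales of the real SLE_κ flow (Lawler (2005),
proof of Prop. 1.21 / Prop. 6.8; Rohde–Schramm (2005), proof of Lemma 6.2 and Lemma 6.5), i.e.
behind the named facts `Literature.Probability.RandomPlanarGeometry.sle_martingale_onePointPow`,
`Literature.Probability.RandomPlanarGeometry.sle_martingale_onePointSq` (`SLEOnePointMartingale`) and,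
downstream, `Literature.Analysis.FunctionSpaces.sle_swallows_real_iff` (`ItoProcesses`).

Let `X = sleRealFlowStop κ x` be the frozen real flow `Xₜ = re gₜ(x) - √κ Bₜ` from `x > 0`
(`0` from `T_x` on), `0 < x₁ < x < x₂`, and `σ` the exit time of `X` from `(x₁, x₂)`. We prove:

* `sleExitTime_eq_exitTime`: Lawler's exit time `Literature.Probability.RandomPlanarGeometry.sleExitTime`
  (minimum of two first hitting times, `SLEOnePointMartingale`) *is* the exit time
  `Literature.Probability.Process.exitTime` of `ContinuousHitting`, so that the stopping-time and
  stopped-process API of that file applies (`isStoppingTime_exitTime_sleRealFlowStop`,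
  `stronglyAdapted_stoppedProcess_sleRealFlowStop`, `stoppedProcess_sleRealFlowStop_mem_Icc'`);
* `martingale_generator_sleRealFlowStop`: **for `F ∈ C²(ℝ)` with `(2/u)F'(u) + (κ/2)F''(u) = c`
  on `[x₁, x₂]`, the process `F(X_{t∧σ}) - c (t∧σ)` is a martingale** for the raw Brownian
  filtration under the (pre-)Wiener measure. Proof: `X^σ` is an Itô process with the cut
  coefficients `b = (2/X^σ)𝟙_{[0,σ]}`, `σ_s = -√κ 𝟙_{[0,σ]}`
  (`isItoProcess_stoppedProcess_sleRealFlowStop` of `SLERealFlowIto`, the flow being `≥ x₁ > 0` up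
  to `σ`); Itô's formula for Itô processes (`Literature.Analysis.FunctionSpaces.ito_formula_itoProcess_ae_of`,
  proved in the tree) gives a.s. `F(X_{t∧σ}) = F(x) + c(t∧σ) + K_t` with `K = ∫ σ_s F'(X^σ_s) dB_s`,
  a martingale since its integrand is bounded and progressive
  (`Process.exists_isItoIntegral_of_sqErr_ne_top`); `F(X^σ) - c(t∧σ)` is its adapted modification.

The instances `F = u^{1-4/κ}`, `F = log u` (`κ = 4`), `F = u²` and the passage `x₁ → 0+` follow
in the sequel `SLEOnePointItoStepsProofs`.

## Mathlib / Literature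

We USE Mathlib's `MeasureTheory.hittingAfter`, `IsStoppingTime` (`.min_const`, `.measurable_of_le`,
`.measurableSet_lt`), `stoppedProcess`, `Martingale`, `condExp_congr_ae`; the tree's
`ContinuousHitting`, `SLERealFlowIto` (Itô-process structure of the stopped flow) and the Itô stack
(`ItoProcessesProofs`, `ProgressiveDensity`, `ItoFormulaProofs`, `LocalMartingaleProofs`).

## References

* G. F. Lawler, *Conformally Invariant Processes in the Plane*, AMS (2005), §1.10 (proof of
  Prop. 1.21), §6.2 eq. (6.3), Prop. 6.8.
* S. Rohde, O. Schramm, *Basic properties of SLE*, Ann. of Math. 161 (2005), §6, proof of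
  Lemma 6.2 ("Itô's formula shows that `F(Y_x(t ∧ T))` is a local martingale, and since `F` is
  bounded in `[a,b]`, this is a martingale"; `dY_x = (2/Y_x) dt + dξ`).
* D. Revuz, M. Yor, *Continuous Martingales and Brownian Motion* (3rd ed., 1999), Ch. I
  Prop. (4.6); Ch. IV Prop. (2.5), Thm (3.3); Ch. IX Def. (1.2).
-/

noncomputable section

open MeasureTheory ProbabilityTheory Filter Set Complex
open scoped NNReal ENNReal Topology

namespace Literature.Probability.RandomPlanarGeometry

/-! ### Hitting-time plumbing: Lawler's exit time is the exit time of `ContinuousHitting` -/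

/-- The first hitting time of a union is the minimum of the first hitting times. [folklore] -/
theorem firstHit_union (γ : ℝ≥0 → ℂ) (S S' : Set ℂ) :
    firstHit γ (S ∪ S') = min (firstHit γ S) (firstHit γ S') := by
  unfold firstHit
  rw [show {t : ℝ≥0 | γ t ∈ S ∪ S'} = {t | γ t ∈ S} ∪ {t | γ t ∈ S'} from rfl, Set.image_union,
    sInf_union]

/-- The first hitting time of `{z | re z ∈ s}` by the complexification of a real path is the
Mathlib hitting time of `s` by the real path. [folklore] -/
theorem firstHit_ofReal_setOf_re_mem {Ω : Type*} (u : ℝ≥0 → Ω → ℝ) (s : Set ℝ) (ω : Ω) :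
    firstHit (fun t ↦ ((u t ω : ℝ) : ℂ)) {z | z.re ∈ s} = hittingAfter u s 0 ω := by
  rw [firstHit_eq_hittingAfter (fun t ω ↦ ((u t ω : ℝ) : ℂ)) {z | z.re ∈ s} ω, hittingAfter_def,
    hittingAfter_def]
  simp only [Set.mem_setOf_eq, Complex.ofReal_re]
  split_ifs <;> rfl

/-- **Lawler's exit time `σ` of the frozen real SLE_κ flow from `(x₁, x₂)`
(`Literature.Probability.RandomPlanarGeometry.sleExitTime`, the minimum of the first hitting times of `{re ≤ x₁}` and
`{x₂ ≤ re}`) is the exit time `Literature.Probability.Process.exitTime` of the real process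
`sleRealFlowStop κ x` from the open interval `(x₁, x₂)`** (first hitting time of `(x₁, x₂)ᶜ`).
[folklore] -/
theorem sleExitTime_eq_exitTime (κ : ℝ≥0) (x x₁ x₂ : ℝ) :
    sleExitTime κ x x₁ x₂ = Process.exitTime (sleRealFlowStop κ x) x₁ x₂ := by
  funext ω
  simp only [sleExitTime, Loewner.exitTime, Loewner.lowerTime, Loewner.levelTime]
  rw [← firstHit_union]
  have hset : ({z : ℂ | z.re ≤ x₁} ∪ {z | x₂ ≤ z.re}) = {z | z.re ∈ (Set.Ioo x₁ x₂)ᶜ} := by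
    ext z
    simp only [Set.mem_union, Set.mem_setOf_eq, Set.mem_compl_iff, Set.mem_Ioo, not_and_or, not_lt]
  rw [hset]
  exact firstHit_ofReal_setOf_re_mem (sleRealFlowStop κ x) _ ω

/-! ### The frozen real SLE_κ flow stopped at the exit time of `(x₁, x₂)` -/

section StoppedFlow

open Loewner Literature.Analysis.FunctionSpaces

variable {κ : ℝ≥0} {x x₁ x₂ : ℝ}

/-- **The exit time of the frozen real SLE_κ flow from `(x₁, x₂)` is a stopping time** of the raw
Brownian filtration (hitting time of a closed set by a continuous adapted process,
`Process.isStoppingTime_exitTime`). Revuz–Yor (1999), Ch. I, Prop. (4.6). [folklore] -/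
theorem isStoppingTime_exitTime_sleRealFlowStop (κ : ℝ≥0) (hx : 0 < x) (x₁ x₂ : ℝ) :
    IsStoppingTime brownianFiltration (Process.exitTime (sleRealFlowStop κ x) x₁ x₂) :=
  Process.isStoppingTime_exitTime (adapted_sleRealFlowStop κ hx.ne') (continuous_sleRealFlowStop hx.ne')

/-- The frozen real SLE_κ flow stopped at its exit time from `(x₁, x₂)` is strongly adapted.
[folklore] -/
theorem stronglyAdapted_stoppedProcess_sleRealFlowStop (κ : ℝ≥0) (hx : 0 < x) (x₁ x₂ : ℝ) :
    StronglyAdapted brownianFiltration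
      (stoppedProcess (sleRealFlowStop κ x) (Process.exitTime (sleRealFlowStop κ x) x₁ x₂)) :=
  Process.stronglyAdapted_stoppedProcess_exitTime (adapted_sleRealFlowStop κ hx.ne')
    (continuous_sleRealFlowStop hx.ne')

/-- The stopped frozen flow has continuous paths. [folklore] -/
theorem continuous_stoppedProcess_sleRealFlowStop (hx : 0 < x) (τ : (ℝ≥0 → ℝ) → WithTop ℝ≥0)
    (ω : ℝ≥0 → ℝ) : Continuous fun t ↦ stoppedProcess (sleRealFlowStop κ x) τ t ω :=
  Process.continuous_stoppedProcess_path (continuous_sleRealFlowStop hx.ne' ω) τ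

/-- The stopped frozen flow is strongly progressive. [folklore] -/
theorem isStronglyProgressive_stoppedProcess_sleRealFlowStop (κ : ℝ≥0) (hx : 0 < x) (x₁ x₂ : ℝ) :
    IsStronglyProgressive brownianFiltration
      (stoppedProcess (sleRealFlowStop κ x) (Process.exitTime (sleRealFlowStop κ x) x₁ x₂)) :=
  StronglyAdapted.isStronglyProgressive_of_continuous
    (stronglyAdapted_stoppedProcess_sleRealFlowStop κ hx x₁ x₂)
    (continuous_stoppedProcess_sleRealFlowStop hx _)

/-- **The stopped frozen flow stays in `[x₁, x₂]`** when `x₁ < x < x₂` (every path). [folklore] -/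
theorem stoppedProcess_sleRealFlowStop_mem_Icc' (hx : 0 < x) (hx₁ : x₁ < x) (hx₂ : x < x₂)
    (t : ℝ≥0) (ω : ℝ≥0 → ℝ) :
    stoppedProcess (sleRealFlowStop κ x) (Process.exitTime (sleRealFlowStop κ x) x₁ x₂) t ω ∈
      Icc x₁ x₂ :=
  Process.stoppedProcess_exitTime_mem_Icc (continuous_sleRealFlowStop hx.ne' ω)
    (by rw [sleRealFlowStop_zero_apply hx.ne']; exact ⟨hx₁, hx₂⟩) t

/-! ### Inputs for the Itô-process structure of the stopped flow (`SLERealFlowIto`) -/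

/-- **The frozen flow does not vanish up to the exit time** of `(x₁, x₂)`, `0 < x₁ < x < x₂`
(it is `≥ x₁` there): the hypothesis `hρX` of `isItoProcess_stoppedProcess_sleRealFlowStop`
(`SLERealFlowIto`) for `ρ` the exit time. [folklore] -/
theorem sleRealFlowStop_ne_zero_of_le_exitTime (hx₁ : 0 < x₁) (hx₁x : x₁ < x) (hxx₂ : x < x₂)
    (ω : ℝ≥0 → ℝ) (t : ℝ≥0)
    (ht : (t : WithTop ℝ≥0) ≤ Process.exitTime (sleRealFlowStop κ x) x₁ x₂ ω) :
    sleRealFlowStop κ x t ω ≠ 0 := by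
  have hmem := stoppedProcess_sleRealFlowStop_mem_Icc' (κ := κ) (hx₁.trans hx₁x) hx₁x hxx₂ t ω
  rw [stoppedProcess_eq_of_le ht] at hmem
  exact (hx₁.trans_le hmem.1).ne'

/-- The cut diffusion coefficient `-√κ 𝟙_{[0,σ]}` is bounded by `√κ`. [folklore] -/
theorem abs_trunc_neg_sqrt_le (κ : ℝ≥0) (ρ : (ℝ≥0 → ℝ) → WithTop ℝ≥0) (s : ℝ≥0) (ω : ℝ≥0 → ℝ) :
    |trunc ρ (fun _ _ ↦ -Real.sqrt κ) s ω| ≤ Real.sqrt κ := by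
  rw [trunc_apply]
  split_ifs
  · rw [abs_neg, abs_of_nonneg (Real.sqrt_nonneg _)]
  · rw [abs_zero]; exact Real.sqrt_nonneg _

/-- A uniformly bounded integrand has finite `L²(ds ⊗ μ)` size on every `[0, t]` (finite
measure): the finiteness hypothesis of `Process.exists_isItoIntegral_of_sqErr_ne_top`. [folklore] -/
theorem sqErr_zero_ne_top_of_abs_le {Ω : Type*} {m : MeasurableSpace Ω} {μ : Measure Ω}
    [IsFiniteMeasure μ] {H : ℝ≥0 → Ω → ℝ} {M : ℝ} (hM : ∀ t ω, |H t ω| ≤ M) (t : ℝ≥0) :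
    Process.sqErr H 0 μ t ≠ ∞ := by
  refine ne_top_of_le_ne_top (b := ENNReal.ofReal (M ^ 2) * ENNReal.ofReal t * μ Set.univ)
    (ENNReal.mul_ne_top (ENNReal.mul_ne_top ENNReal.ofReal_ne_top ENNReal.ofReal_ne_top)
      (measure_ne_top _ _)) ?_
  unfold Process.sqErr
  have hinner : ∀ ω, (∫⁻ s in Icc (0 : ℝ) t, ENNReal.ofReal
      ((H s.toNNReal ω - (0 : ℝ≥0 → Ω → ℝ) s.toNNReal ω) ^ 2)) ≤
      ENNReal.ofReal (M ^ 2) * ENNReal.ofReal t := by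
    intro ω
    calc (∫⁻ s in Icc (0 : ℝ) t, ENNReal.ofReal ((H s.toNNReal ω - (0 : ℝ≥0 → Ω → ℝ) s.toNNReal ω) ^ 2))
        ≤ ∫⁻ _ in Icc (0 : ℝ) t, ENNReal.ofReal (M ^ 2) := by
          refine setLIntegral_mono measurable_const fun s _ ↦ ENNReal.ofReal_le_ofReal ?_
          simp only [Pi.zero_apply, sub_zero]
          exact (sq_abs (H s.toNNReal ω)) ▸ pow_le_pow_left₀ (abs_nonneg _) (hM _ ω) 2
      _ = ENNReal.ofReal (M ^ 2) * ENNReal.ofReal t := by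
          rw [setLIntegral_const, Real.volume_Icc, sub_zero]
  calc (∫⁻ ω, (∫⁻ s in Icc (0 : ℝ) t, ENNReal.ofReal
        ((H s.toNNReal ω - (0 : ℝ≥0 → Ω → ℝ) s.toNNReal ω) ^ 2)) ∂μ)
      ≤ ∫⁻ _, ENNReal.ofReal (M ^ 2) * ENNReal.ofReal t ∂μ := lintegral_mono hinner
    _ = ENNReal.ofReal (M ^ 2) * ENNReal.ofReal t * μ Set.univ := by rw [lintegral_const]

end StoppedFlow

/-! ### Generator martingales of the stopped flow -/

section Generator

open Loewner Literature.Analysis.FunctionSpaces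

variable {κ : ℝ≥0} {x x₁ x₂ : ℝ}

/-- The stopped clock `ω ↦ t ∧ σ(ω)` of the exit time is `𝓕ᵂ_t`-measurable (`t ∧ σ` is a stopping
time bounded by `t`). [folklore] -/
theorem measurable_untopA_min_exitTime (κ : ℝ≥0) (hx : 0 < x) (x₁ x₂ : ℝ) (t : ℝ≥0) :
    Measurable[brownianFiltration t] fun ω ↦
      (min (t : WithTop ℝ≥0) (Process.exitTime (sleRealFlowStop κ x) x₁ x₂ ω)).untopA := by
  have hst := (isStoppingTime_exitTime_sleRealFlowStop κ hx x₁ x₂).min_const t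
  have hmeas : Measurable[brownianFiltration t] fun ω ↦
      min (Process.exitTime (sleRealFlowStop κ x) x₁ x₂ ω) (t : WithTop ℝ≥0) :=
    hst.measurable_of_le fun ω ↦ min_le_right _ _
  have := hmeas.untopA
  simpa only [min_comm] using this

/-- **Generator martingales of the real SLE_κ flow** (the Itô step of Lawler (2005), proof of
Prop. 1.21, and of Rohde–Schramm (2005), proof of Lemma 6.2: "Itô's formula shows that
`F(Y_x(t ∧ T))` is a local martingale, and since `F` is bounded in `[a,b]`, this is a
martingale"). Let `0 < x₁ < x < x₂`, `X` the frozen real SLE_κ flow from `x`, `σ` its exit time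
from `(x₁, x₂)`, and `F ∈ C²(ℝ)` with `(2/u) F'(u) + (κ/2) F''(u) = c` on `[x₁, x₂]`. Then
`F(X_{t∧σ}) - c (t ∧ σ)` is a martingale for the raw Brownian filtration under the (pre-)Wiener
measure. Proof: `X^σ` is the Itô process `x + ∫ b ds + ∫ σ dB` with `b = (2/X)𝟙_{[0,σ]}`,
`σ_s = -√κ 𝟙_{[0,σ]}` (`isItoProcess_stoppedProcess_sleRealFlowStop` of `SLERealFlowIto`); by the tree's Itô formula
(`Literature.Analysis.FunctionSpaces.ito_formula_itoProcess_ae_of`) a.s. for all `t`,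
`F(X_{t∧σ}) = F(x) + ∫₀ᵗ (b F'(X^σ) + ½ σ² F''(X^σ)) ds + K_t = F(x) + c (t∧σ) + K_t`, where
`K = ∫ σ F'(X^σ) dB` has a bounded progressive integrand and is therefore a (square-integrable)
martingale (`Process.exists_isItoIntegral_of_sqErr_ne_top`). [cite: RohdeSchramm2005, §6 proof of Lemma 6.2] -/
theorem martingale_generator_sleRealFlowStop (hx₁ : 0 < x₁) (hx₁x : x₁ < x) (hxx₂ : x < x₂)
    {F : ℝ → ℝ} (hF : ContDiff ℝ 2 F) {c : ℝ}
    (hgen : ∀ u ∈ Icc x₁ x₂, 2 / u * deriv F u + (κ : ℝ) / 2 * iteratedDeriv 2 F u = c) :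
    Martingale (fun t ω ↦
        F (stoppedProcess (sleRealFlowStop κ x) (Process.exitTime (sleRealFlowStop κ x) x₁ x₂) t ω) -
          c * ((min (t : WithTop ℝ≥0) (Process.exitTime (sleRealFlowStop κ x) x₁ x₂ ω)).untopA : ℝ))
      brownianFiltration Process.preWienerMeasure := by
  haveI := isProbabilityMeasure_preWienerMeasure'
  have hx : 0 < x := hx₁.trans hx₁x
  set X := sleRealFlowStop κ x with hX
  set σ := Process.exitTime X x₁ x₂ with hσ
  set Y := stoppedProcess X σ with hY
  set b : ℝ≥0 → (ℝ≥0 → ℝ) → ℝ := trunc σ fun s ω ↦ 2 / Y s ω with hb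
  set σ' : ℝ≥0 → (ℝ≥0 → ℝ) → ℝ := trunc σ fun _ _ ↦ -Real.sqrt κ with hσ'
  have hσst : IsStoppingTime brownianFiltration σ := isStoppingTime_exitTime_sleRealFlowStop κ hx x₁ x₂
  have hσopt : ∀ t : ℝ≥0, MeasurableSet[brownianFiltration t] {ω | σ ω < t} := fun t ↦
    hσst.measurableSet_lt t
  have hYito : IsItoProcess Y b σ' Process.brownian brownianFiltration Process.preWienerMeasure :=
    isItoProcess_stoppedProcess_sleRealFlowStop hx.ne' hσst
      (sleRealFlowStop_ne_zero_of_le_exitTime hx₁ hx₁x hxx₂)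
  have hYprog : IsStronglyProgressive brownianFiltration Y :=
    isStronglyProgressive_stoppedProcess_sleRealFlowStop κ hx x₁ x₂
  have hYadapt : Adapted brownianFiltration Y := hYprog.stronglyAdapted.adapted
  have hσ'prog : IsStronglyProgressive brownianFiltration σ' :=
    isStronglyProgressive_trunc (isStronglyProgressive_const _ _) hσopt
  have hYmem : ∀ t ω, Y t ω ∈ Icc x₁ x₂ := stoppedProcess_sleRealFlowStop_mem_Icc' hx hx₁x hxx₂
  have hY0 : ∀ ω, Y 0 ω = x := fun ω ↦ by
    rw [hY, stoppedProcess, untopA_min_zero, hX, sleRealFlowStop_zero_apply hx.ne']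
  -- the integrand `σ F'(X^σ)` of the stochastic integral is progressive and bounded
  have hF' : Continuous (deriv F) := hF.continuous_deriv (by norm_num)
  obtain ⟨C, hC⟩ := (isCompact_Icc (a := x₁) (b := x₂)).exists_bound_of_continuousOn hF'.continuousOn
  set H : ℝ≥0 → (ℝ≥0 → ℝ) → ℝ := fun t ω ↦ σ' t ω * deriv F (Y t ω) with hH
  have hHprog : IsStronglyProgressive brownianFiltration H :=
    hσ'prog.mul (Literature.Analysis.FunctionSpaces.IsStronglyProgressive.comp_measurable₂ hYprog
      (F := fun _ u ↦ deriv F u) (hF'.measurable.comp measurable_snd))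
  have hHbound : ∀ t ω, |H t ω| ≤ Real.sqrt κ * C := by
    intro t ω
    simp only [hH, abs_mul]
    refine mul_le_mul (abs_trunc_neg_sqrt_le κ σ t ω) ?_ (abs_nonneg _)
      (Real.sqrt_nonneg _)
    simpa only [Real.norm_eq_abs] using hC _ (hYmem t ω)
  obtain ⟨K, hK, hKmart, -⟩ := Process.exists_isItoIntegral_of_sqErr_ne_top
    martingale_brownian_holds martingale_brownian_sq_sub_holds memLp_two_brownian
    Process.continuous_brownian hHprog (sqErr_zero_ne_top_of_abs_le hHbound)
  -- Itô's formula for `f(t, u) = F(u)` along the Itô process `Y`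
  have hf : ContDiff ℝ 2 (Function.uncurry fun (_ : ℝ) (u : ℝ) ↦ F u) := hF.comp contDiff_snd
  have hito : ∀ᵐ ω ∂Process.preWienerMeasure, ∀ t : ℝ≥0,
      F (Y t ω) = F (Y 0 ω) +
        (∫ s in (0 : ℝ)..t, (deriv (fun _ : ℝ ↦ F (Y s.toNNReal ω)) (s.toNNReal : ℝ) +
          b s.toNNReal ω * deriv F (Y s.toNNReal ω) +
          2⁻¹ * σ' s.toNNReal ω ^ 2 * iteratedDeriv 2 F (Y s.toNNReal ω))) + K t ω :=
    ito_formula_itoProcess_ae_of (f := fun _ u ↦ F u) hf hYadapt hσ'prog hYito hK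
  -- the drift of `F(Y)` is `c 𝟙_{[0,σ]}`
  have hintegrand : ∀ ω (s : ℝ), deriv (fun _ : ℝ ↦ F (Y s.toNNReal ω)) (s.toNNReal : ℝ) +
      b s.toNNReal ω * deriv F (Y s.toNNReal ω) +
      2⁻¹ * σ' s.toNNReal ω ^ 2 * iteratedDeriv 2 F (Y s.toNNReal ω) =
      trunc σ (fun _ _ ↦ c) s.toNNReal ω := by
    intro ω s
    rw [deriv_const, zero_add, trunc_apply, hb, trunc_apply, hσ', trunc_apply]
    split_ifs with h
    · have hg := hgen _ (hYmem s.toNNReal ω)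
      rw [neg_sq, Real.sq_sqrt κ.coe_nonneg]
      linarith
    · simp
  have hint_eq : ∀ ω (t : ℝ≥0), (∫ s in (0 : ℝ)..t,
      (deriv (fun _ : ℝ ↦ F (Y s.toNNReal ω)) (s.toNNReal : ℝ) +
        b s.toNNReal ω * deriv F (Y s.toNNReal ω) +
        2⁻¹ * σ' s.toNNReal ω ^ 2 * iteratedDeriv 2 F (Y s.toNNReal ω))) =
      c * ((min (t : WithTop ℝ≥0) (σ ω)).untopA : ℝ) := by
    intro ω t
    simp_rw [hintegrand ω]
    have := timeIntegral_trunc (fun (_ : ℝ≥0) (_ : ℝ≥0 → ℝ) ↦ c) σ t ω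
    simp only [timeIntegral] at this
    rw [this, intervalIntegral.integral_const, smul_eq_mul, sub_zero, mul_comm]
  have hpath : ∀ᵐ ω ∂Process.preWienerMeasure, ∀ t : ℝ≥0,
      F (Y t ω) - c * ((min (t : WithTop ℝ≥0) (σ ω)).untopA : ℝ) = F x + K t ω := by
    filter_upwards [hito] with ω hω t
    rw [hω t, hint_eq ω t, hY0 ω]
    ring
  -- `F(x) + K` is a martingale, and so is its adapted modification `F(Y) - c (t ∧ σ)`
  have hN : Martingale (fun t ω ↦ F x + K t ω) brownianFiltration Process.preWienerMeasure :=
    (martingale_const brownianFiltration Process.preWienerMeasure (F x)).add hKmart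
  have hMadapt : StronglyAdapted brownianFiltration fun t ω ↦
      F (Y t ω) - c * ((min (t : WithTop ℝ≥0) (σ ω)).untopA : ℝ) := by
    intro t
    refine Measurable.stronglyMeasurable ?_
    refine (hF.continuous.measurable.comp (hYprog.stronglyAdapted t).measurable).sub
      (measurable_const.mul ?_)
    exact measurable_coe_nnreal_real.comp (measurable_untopA_min_exitTime κ hx x₁ x₂ t)
  refine ⟨hMadapt, fun s t hst ↦ ?_⟩
  have h1 : (fun ω ↦ F (Y t ω) - c * ((min (t : WithTop ℝ≥0) (σ ω)).untopA : ℝ)) =ᵐ[Process.preWienerMeasure]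
      fun ω ↦ F x + K t ω := hpath.mono fun ω hω ↦ hω t
  have h2 : (fun ω ↦ F (Y s ω) - c * ((min (s : WithTop ℝ≥0) (σ ω)).untopA : ℝ)) =ᵐ[Process.preWienerMeasure]
      fun ω ↦ F x + K s ω := hpath.mono fun ω hω ↦ hω s
  calc Process.preWienerMeasure[fun ω ↦ F (Y t ω) - c * ((min (t : WithTop ℝ≥0) (σ ω)).untopA : ℝ) |
        brownianFiltration s]
      =ᵐ[Process.preWienerMeasure] Process.preWienerMeasure[fun ω ↦ F x + K t ω | brownianFiltration s] :=
        condExp_congr_ae h1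
    _ =ᵐ[Process.preWienerMeasure] fun ω ↦ F x + K s ω := hN.condExp_ae_eq hst
    _ =ᵐ[Process.preWienerMeasure] fun ω ↦ F (Y s ω) - c * ((min (s : WithTop ℝ≥0) (σ ω)).untopA : ℝ) :=
        h2.symm

end Generator

end Literature.Probability.RandomPlanarGeometry
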